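import Summits.ResolutionOfSingularities.ResolutionOfSingularities.Theorems.HilbertSamuelEliminationSigmaMaxModificationsCorridor3TameWildNuGluing
import Summits.ResolutionOfSingularities.ResolutionOfSingularities.Theorems.HilbertSamuelEliminationSigmaMaxModificationsLocalWitness
import Summits.ResolutionOfSingularities.ResolutionOfSingularities.Theorems.HilbertSamuelEliminationSigmaMaxModificationsMaxLocusClosed
import Summits.ResolutionOfSingularities.ResolutionOfSingularities.Theorems.HilbertSamuelEliminationSigmaMaxModificationsSemicontinuitySharp
import Literature.AlgebraicGeometry.Resolution.QuasiExcellentSchemes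
import Literature.AlgebraicGeometry.Resolution.ExcellentRingsFieldProofs
import Mathlib.AlgebraicGeometry.Morphisms.Proper
import Mathlib.AlgebraicGeometry.Noetherian
import HarnessLib

/-!
# Route `HilbertSamuelElimination`, crux `SigmaMaxModificationsCorridor3`
# (stmt-ResolutionOfSingularities-19249; child of `SigmaMaxModifications` stmt-…-18506),
# line `tame_wild` — stub `stub_isolatedNu3`: `ν`-modifications of ISOLATED maximal strata

[OURS · L1 W4.2] Stub `stub_isolatedNu3` of the registered skeleton
`Cruxes/SigmaMaxModificationsCorridor3/Lines/tame_wild.lean` (item stmt-ResolutionOfSingularities-19249),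
BY NAME AND SIGNATURE (`NuMod` = `Theorems.SigmaMaxModificationsCorridor3.TameWild.NuMod`, the
Theorems-side copy of the line's definition): from the named fact `CossartPiltant2019General`
(Cossart–Piltant 2019, Thm. 1.1: every reduced separated Noetherian quasi-excellent scheme of
dimension `≤ 3` has a resolution which is an isomorphism over its regular locus), every maximal
value `ν ≠ Φ^{(3)}` of `Σ_Y(3)` of a reduced separated finite-type `Y/k` with `dim Y ≤ 3` whose
stratum `Y(ν)` is ISOLATED FROM THE OTHER SINGULARITIES
(`Disjoint (closure (Sing Y ∖ Y(ν))) Y(ν)`) admits a `ν`-modification at level `3` inside the class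
`{dim ≤ 3}` (CJS Def. 6.14 in modification form). It is the hypothesis `hIso` of the landed regime
glue `sigmaMaxModificationsCorridor3_of_regimes`. NOT a statement of any manuscript.

Proof (the `ν`-wise analogue of the landed `sigmaMaxModifications_dim_le_three_of_isolated`,
p154168, with `X_max` replaced by the stratum `Y(ν)` and the density clause upgraded to "dense opens
inside `Y ∖ Y(ν)` pull back to dense opens"):

* `Y(ν)` is closed: `ν` is maximal and `H^3_Y` is upper semicontinuous at the level `3 ≥ dim Y`
  over a field (landed `stub_isClosed_hsMaxLocus_over_field` ∘ `stub_hsFun_le_of_specializes_over_field`,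
  then `Scheme.isClosed_hsStratum_of_maximal`).
* `U₁ := Y ∖ closure (Sing Y ∖ Y(ν))` is an open neighbourhood of `Y(ν)` all of whose points outside
  `Y(ν)` are regular; `Zc := Y ∖ Y(ν)`; `Zc ∪ U₁ = Y`.
* Resolve `U₁` by the fact (`ρ : W → U₁`, an isomorphism over `Reg U₁ ⊇ U₁ ∩ Zc`). It is a LOCAL
  `ν`-WITNESS (`nuLocalWitness_of_resolution`): proper, `W` reduced of dimension `≤ dim U₁ ≤ dim Y`,
  an isomorphism over `U₁ ∩ Zc`, every dense open of `Y` pulls back to a dense open of `W`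
  (birationality), `H^3_W = Φ^{(3)} ≤ H^3_Y` pointwise (CJS Rem. 2.32), and `ν ≠ Φ^{(3)}` is not a
  value of `Σ_W`.
* Glue `ρ` with the identity of `Zc` along `ρ⁻¹(U₁ ∩ Zc) ≅ U₁ ∩ Zc` (landed-shape `ν`-gluing
  `nuMod_of_localWitness`, file `…Corridor3TameWildNuGluing`).

The general form `nuMod_of_isolated_of_resolutions` is stated for any dimension bound `d` and any
level `N ≥ dim Y`, conditional on resolutions (iso over `Reg`) in dimension `≤ d`; the registered
stub is the case `d = N = 3` with Cossart–Piltant; `nuMod_dim_le_three_of_isolated` is every level,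
`nuMod_dim_le_two_of_isolated` the surface case from `CossartJannsenSaito2020General`.

## Sources

* V. Cossart, O. Piltant, J. Algebra 529 (2019), Thm. 1.1. [CossartPiltant2019]
* V. Cossart, U. Jannsen, S. Saito, LNM 2270 (2020), Def. 2.28, Rem. 2.32, Lemma 2.36, Def. 6.14,
  Rem. 6.24, Thm. 1.2. [CossartJannsenSaito2020]
-/

set_option linter.dupNamespace false -- mandated namespace of this single-conjunct summit

noncomputable section

open CategoryTheory AlgebraicGeometry TopologicalSpace Topology
open Literature.AlgebraicGeometry.Resolution Literature.RingTheory.HilbertSamuel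
open Summit.ResolutionOfSingularities.ResolutionOfSingularities.Theorems.SigmaMaxModifications.Sketch

namespace Summit.ResolutionOfSingularities.ResolutionOfSingularities.Theorems.SigmaMaxModificationsCorridor3.TameWild

/-! ## A resolution of a neighbourhood of the stratum is a local `ν`-witness -/

/-- **A resolution of an open neighbourhood `U₁` of `X(ν)` which is an isomorphism over `Reg U₁`,
when `U₁ ∩ Sing X ⊆ X(ν)`, is a LOCAL `ν`-WITNESS.** For `X` reduced of finite type over a field `k`,
`dim X ≤ d`, `dim X ≤ N`, a value `ν ≠ Φ^{(N)}`, `Zc = X ∖ X(ν)`, an open `U₁ ⊆ X` all of whose points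
outside `X(ν)` are regular points of `X`, and a resolution `ρ : Y ⟶ U₁` (proper, birational, `Y`
regular) which is an isomorphism over an open with underlying set `Reg U₁`: `ρ` is proper, `Y` is
reduced of dimension `≤ d` and `≤ N` (`dim Y ≤ dim U₁` along the birational open), `ρ` is an
isomorphism over `U₁ ∩ Zc ⊆ Reg U₁` (local rings of `U₁` and `X` agree), every dense open `U` of `X`
pulls back to a dense open of `Y` (`U ∩ U₁ ∩ U₀` is a dense open inside the birational open `U₀`),
`H^N_Y = Φ^{(N)} ≤ H^N_X` pointwise (CJS Rem. 2.32), and `ν ≠ Φ^{(N)}` is not a value of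
`Σ_Y = {Φ^{(N)}}`. [cite: CossartJannsenSaito2020, Def. 6.14, Rem. 2.32] [cite: CossartPiltant2019, Thm. 1.1] -/
theorem nuLocalWitness_of_resolution :
    ∀ (k : Type) [Field k] (X : Scheme.{0}) (f : X ⟶ Spec (.of k)), LocallyOfFiniteType f →
      QuasiCompact f → IsReduced X → ∀ (N d : ℕ) (ν : ℕ → ℕ),
      topologicalKrullDim X ≤ (d : WithBot ℕ∞) → topologicalKrullDim X ≤ (N : WithBot ℕ∞) →
      ν ≠ iterPSum N Phi → ∀ (Zc U₁ : X.Opens),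
      (Zc : Set X) = (Scheme.hsStratum X N ν)ᶜ →
      (∀ x : X, x ∈ U₁ → x ∉ Scheme.hsStratum X N ν → x ∈ Scheme.regularLocus X) →
      ∀ (Y : Scheme.{0}) (ρ : Y ⟶ (U₁ : Scheme.{0})), IsResolution ρ →
      (∃ V : (U₁ : Scheme.{0}).Opens,
        (V : Set (U₁ : Scheme.{0})) = Scheme.regularLocus (U₁ : Scheme.{0}) ∧ IsIso (ρ ∣_ V)) →
      IsProper ρ ∧ IsReduced Y ∧ topologicalKrullDim Y ≤ (d : WithBot ℕ∞) ∧
        topologicalKrullDim Y ≤ (N : WithBot ℕ∞) ∧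
        IsIso (ρ ∣_ (U₁.ι ⁻¹ᵁ Zc)) ∧
        (∀ U : X.Opens, Dense (U : Set X) → Dense ((ρ ⁻¹ᵁ (U₁.ι ⁻¹ᵁ U) : Y.Opens) : Set Y)) ∧
        (∀ y : Y, Scheme.hsFun Y N y ≤ Scheme.hsFun X N (U₁.ι.base (ρ.base y))) ∧
        ν ∉ Scheme.hsValues Y N := by
  intro k _ X f hft hqc hred N d ν hdimd hdim hνΦ Zc U₁ hZc hisol Y ρ hres hV
  obtain ⟨V, hV, hisoV⟩ := hV
  haveI := hft
  haveI := hqc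
  haveI := hred
  -- instances: `X`, `U₁`, `Y` are Noetherian (finite type over `k`; `ρ` is proper)
  haveI : IsNoetherian X := Scheme.isNoetherian_of_finiteType_over_field f
  haveI : IsProper ρ := hres.isProper
  haveI : IsNoetherian Y := Scheme.isNoetherian_of_finiteType_over_field (ρ ≫ U₁.ι ≫ f)
  -- the open `U₁ ∩ Zc` of `U₁` lies inside `Reg U₁ = V`
  have hW'V : U₁.ι ⁻¹ᵁ Zc ≤ V := by
    intro u hu
    have huZ : U₁.ι.base u ∈ (Zc : Set X) := hu
    rw [hZc] at huZ
    have hureg : U₁.ι.base u ∈ Scheme.regularLocus X := hisol _ u.2 huZ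
    show u ∈ (V : Set (U₁ : Scheme.{0}))
    rw [hV]
    exact (mem_regularLocus_iff_of_flat_of_isPreimmersion U₁.ι u).mpr hureg
  -- dimension: `dim Y ≤ dim U₁ ≤ dim X` along the birational open `U₀`
  obtain ⟨U₀, hU₀d, hdU₀, hisoU₀⟩ := hres.isBirational
  haveI := hisoU₀
  have hdimYX : topologicalKrullDim Y ≤ topologicalKrullDim X :=
    le_trans (Summit.ResolutionOfSingularities.ResolutionOfSingularities.Theorems.ModificationsResolve.Sketch.stub_topologicalKrullDim_le_of_isIso_restrict
      (U₁.ι ≫ f) ρ U₀ hdU₀) U₁.ι.isOpenEmbedding.isInducing.topologicalKrullDim_le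
  have hdimY : topologicalKrullDim Y ≤ (N : WithBot ℕ∞) := hdimYX.trans hdim
  -- every Hilbert–Samuel function of the regular scheme `Y` is `Φ^{(N)}`
  have hstalkY : ∀ y : Y, ∃ e : ℕ, ringKrullDim (Y.presheaf.stalk y) = e ∧ e ≤ N :=
    exists_ringKrullDim_stalk_eq_of_topologicalKrullDim_le hdimY
  have hYval : ∀ y : Y, Scheme.hsFun Y N y = iterPSum N Phi := fun y => by
    obtain ⟨e, he, heN⟩ := hstalkY y
    exact Scheme.hsFun_of_mem_regularLocus (hres.isRegular y) he heN
  -- `ρ` is an isomorphism over `U₁ ∩ Zc ≤ V`; dense opens of `X` pull back to dense opens of `Y`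
  have hisoW' : IsIso (ρ ∣_ (U₁.ι ⁻¹ᵁ Zc)) := isIso_morphismRestrict_of_le ρ hisoV hW'V
  have hdense : ∀ U : X.Opens, Dense (U : Set X) →
      Dense ((ρ ⁻¹ᵁ (U₁.ι ⁻¹ᵁ U) : Y.Opens) : Set Y) := by
    intro U hU
    have h0 : Dense ((U₁.ι ⁻¹ᵁ U : (U₁ : Scheme.{0}).Opens) : Set (U₁ : Scheme.{0})) :=
      hU.preimage U₁.2.isOpenMap_subtype_val
    have h1 : Dense (((U₁.ι ⁻¹ᵁ U) ⊓ U₀ : (U₁ : Scheme.{0}).Opens) : Set (U₁ : Scheme.{0})) := by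
      rw [Opens.coe_inf]
      exact h0.inter_of_isOpen_right hU₀d U₀.isOpen
    have h2 := dense_preimage_of_isIso_morphismRestrict ρ U₀ hdU₀ h1 inf_le_right
    exact h2.mono fun y hy => (show ρ.base y ∈ (U₁.ι ⁻¹ᵁ U) ⊓ U₀ from hy).1
  -- monotonicity and the killing of `ν`
  refine ⟨hres.isProper, hres.isRegular.isReduced, hdimYX.trans hdimd, hdimY, hisoW', hdense,
    fun y => ?_, fun hνY => ?_⟩
  · rw [hYval y]
    exact Scheme.iterPSum_Phi_le_hsFun N _
  · obtain ⟨y, hy⟩ := hνY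
    rw [hYval y] at hy
    exact hνΦ hy.symm

/-! ## The stub -/

/-- **A `ν`-modification of an ISOLATED maximal stratum follows from resolution of singularities
(iso over the regular locus) in the same dimension.** If every reduced separated excellent Noetherian
scheme of dimension `≤ d` has a resolution which is an isomorphism over (an open equal to) its regular
locus, then for `X/k` reduced, separated, locally of finite type and quasi-compact, `dim X ≤ d`,
`dim X ≤ N`, and a maximal value `ν ≠ Φ^{(N)}` of `Σ_X(N)` whose stratum `X(ν)` is disjoint from the
closure of `Sing X ∖ X(ν)`, there is a `ν`-modification of `X` at level `N` inside the class
`{dim ≤ d}`: `X(ν)` is closed (sharp semicontinuity over a field at `N ≥ dim X`, `ν` maximal); resolve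
the open neighbourhood `U₁ = X ∖ closure (Sing X ∖ X(ν))` of `X(ν)` (its points outside `X(ν)` are
regular, so the resolution is a local `ν`-witness, `nuLocalWitness_of_resolution`) and glue with the
identity on `X ∖ X(ν)` (`nuMod_of_localWitness`).
[cite: CossartJannsenSaito2020, Def. 6.14, Rem. 6.24, Lemma 2.36] -/
theorem nuMod_of_isolated_of_resolutions (d : ℕ)
    (hRes : ∀ (Y : Scheme.{0}) [Y.IsSeparated] [IsNoetherian Y] [IsReduced Y],
      Scheme.IsExcellent Y → topologicalKrullDim Y ≤ (d : WithBot ℕ∞) →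
        ∃ (Y' : Scheme.{0}) (ρ : Y' ⟶ Y), IsResolution ρ ∧
          ∃ V : Y.Opens, (V : Set Y) = Scheme.regularLocus Y ∧ IsIso (ρ ∣_ V))
    {k : Type} [Field k] {X : Scheme.{0}} (f : X ⟶ Spec (.of k)) [IsSeparated f]
    [LocallyOfFiniteType f] [QuasiCompact f] [IsReduced X]
    (hdimd : topologicalKrullDim X ≤ (d : WithBot ℕ∞)) {N : ℕ}
    (hdim : topologicalKrullDim X ≤ (N : WithBot ℕ∞)) {ν : ℕ → ℕ}
    (hν : Maximal (· ∈ Scheme.hsValues X N) ν) (hνΦ : ν ≠ iterPSum N Phi)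
    (hdisj : Disjoint (closure ((Scheme.regularLocus X)ᶜ \ Scheme.hsStratum X N ν))
      (Scheme.hsStratum X N ν)) :
    NuMod X N d ν := by
  haveI : IsLocallyNoetherian X := LocallyOfFiniteType.isLocallyNoetherian f
  haveI : IsNoetherian X := Scheme.isNoetherian_of_finiteType_over_field f
  -- `X(ν)` is closed: `ν` is maximal and `H^N_X` is upper semicontinuous at `N ≥ dim X` over a field
  have husc : ∀ μ : ℕ → ℕ, IsClosed (Scheme.hsStratumGE X N μ) :=
    (stub_isClosed_hsMaxLocus_over_field stub_hsFun_le_of_specializes_over_field k X f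
      inferInstance inferInstance N hdim).1
  have hcl : IsClosed (Scheme.hsStratum X N ν) := Scheme.isClosed_hsStratum_of_maximal husc hν
  -- the two opens: `Zc = X ∖ X(ν)` and `U₁ = X ∖ closure (Sing X ∖ X(ν)) ⊇ X(ν)`
  let Zc : X.Opens := ⟨(Scheme.hsStratum X N ν)ᶜ, hcl.isOpen_compl⟩
  let T : Set X := closure ((Scheme.regularLocus X)ᶜ \ Scheme.hsStratum X N ν)
  let U₁ : X.Opens := ⟨Tᶜ, isClosed_closure.isOpen_compl⟩
  have hcover : Zc ⊔ U₁ = ⊤ := by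
    ext x
    simp only [Opens.coe_sup, Opens.coe_top, Set.mem_univ, iff_true]
    by_cases hx : x ∈ Scheme.hsStratum X N ν
    · exact Or.inr (Set.disjoint_right.mp hdisj hx)
    · exact Or.inl hx
  have hisol : ∀ x : X, x ∈ U₁ → x ∉ Scheme.hsStratum X N ν → x ∈ Scheme.regularLocus X := by
    intro x hxU hxZ
    by_contra hxreg
    exact hxU (subset_closure ⟨hxreg, hxZ⟩)
  -- resolve `U₁`
  haveI : IsSeparated (U₁.ι ≫ f) := inferInstance
  haveI : (U₁ : Scheme.{0}).IsSeparated := Scheme.isSeparated_of_isSeparated_over (U₁.ι ≫ f)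
  haveI : IsNoetherian (U₁ : Scheme.{0}) :=
    Scheme.isNoetherian_of_finiteType_over_field (U₁.ι ≫ f)
  haveI : IsReduced (U₁ : Scheme.{0}) := isReduced_of_isOpenImmersion U₁.ι
  have hexcU : Scheme.IsExcellent (U₁ : Scheme.{0}) :=
    Scheme.isExcellent_of_locallyOfFiniteType Stacks07QW_field_holds (U₁.ι ≫ f)
  have hdimU : topologicalKrullDim (U₁ : Scheme.{0}) ≤ (d : WithBot ℕ∞) :=
    (U₁.ι.isOpenEmbedding.isEmbedding.isInducing.topologicalKrullDim_le).trans hdimd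
  obtain ⟨Y, ρ, hres, V, hV, hisoV⟩ := hRes (U₁ : Scheme.{0}) hexcU hdimU
  -- it is a local `ν`-witness; glue it with the identity on `Zc`
  obtain ⟨hprop, hYred, hYdimd, hYdim, hiso, hdense, hmono, hkill⟩ :=
    nuLocalWitness_of_resolution k X f inferInstance inferInstance inferInstance N d ν hdimd hdim
      hνΦ Zc U₁ rfl hisol Y ρ hres ⟨V, hV, hisoV⟩
  exact nuMod_of_localWitness X N d ν hdimd hdim Zc U₁ rfl hcover Y ρ hprop hYred hYdimd hYdim hiso
    (fun U hU _ => hdense U hU) hmono hkill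

/-- **STUB `stub_isolatedNu3` of line `tame_wild` (BY NAME AND SIGNATURE): `ν`-modification of an
ISOLATED maximal stratum in dimension `≤ 3`, from Cossart–Piltant 2019 (Thm. 1.1).** For `Y/k`
reduced, separated, locally of finite type and quasi-compact with `dim Y ≤ 3`, a maximal value
`ν ≠ Φ^{(3)}` of `Σ_Y(3)` whose stratum `Y(ν)` is disjoint from `closure (Sing Y ∖ Y(ν))` admits a
`ν`-modification at level `3` inside the class `{dim ≤ 3}`: resolve the open neighbourhood
`Y ∖ closure (Sing Y ∖ Y(ν))` of `Y(ν)` by the named fact (its quasi-excellence is the excellence of a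
finite-type `k`-scheme) and glue with the identity of `Y ∖ Y(ν)`
(`nuMod_of_isolated_of_resolutions` at `d = N = 3`).
[cite: CossartPiltant2019, Thm. 1.1] [cite: CossartJannsenSaito2020, Def. 6.14, Lemma 2.36] -/
theorem stub_isolatedNu3 :
    CossartPiltant2019General.{0} →
    ∀ (k : Type) [Field k] (Y : Scheme.{0}) (g : Y ⟶ Spec (.of k)), IsSeparated g →
      LocallyOfFiniteType g → QuasiCompact g → IsReduced Y →
      topologicalKrullDim Y ≤ ((3 : ℕ) : WithBot ℕ∞) →
      ∀ ν : ℕ → ℕ, Maximal (· ∈ Scheme.hsValues Y 3) ν → ν ≠ iterPSum 3 Phi →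
        Disjoint (closure ((Scheme.regularLocus Y)ᶜ \ Scheme.hsStratum Y 3 ν))
          (Scheme.hsStratum Y 3 ν) →
        NuMod Y 3 3 ν := by
  intro hCP k _ Y g hsep hft hqc hred hdim3 ν hν hνΦ hdisj
  haveI := hsep
  haveI := hft
  haveI := hqc
  haveI := hred
  exact nuMod_of_isolated_of_resolutions 3
    (fun Z _ _ _ hexc hdimZ => hCP Z hexc.isQuasiExcellent (by exact_mod_cast hdimZ)) g hdim3
    hdim3 hν hνΦ hdisj

/-- **The same at every level `N ≥ dim Y`** (conditional on Cossart–Piltant 2019, Thm. 1.1): a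
maximal value `ν ≠ Φ^{(N)}` of `Σ_Y(N)` with isolated stratum admits a `ν`-modification at level `N`
inside the class `{dim ≤ 3}`. [cite: CossartPiltant2019, Thm. 1.1] [cite: CossartJannsenSaito2020, Def. 6.14] -/
theorem nuMod_dim_le_three_of_isolated (hCP : CossartPiltant2019General.{0}) {k : Type} [Field k]
    {Y : Scheme.{0}} (g : Y ⟶ Spec (.of k)) [IsSeparated g] [LocallyOfFiniteType g]
    [QuasiCompact g] [IsReduced Y] (hdim3 : topologicalKrullDim Y ≤ ((3 : ℕ) : WithBot ℕ∞))
    {N : ℕ} (hdim : topologicalKrullDim Y ≤ (N : WithBot ℕ∞)) {ν : ℕ → ℕ}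
    (hν : Maximal (· ∈ Scheme.hsValues Y N) ν) (hνΦ : ν ≠ iterPSum N Phi)
    (hdisj : Disjoint (closure ((Scheme.regularLocus Y)ᶜ \ Scheme.hsStratum Y N ν))
      (Scheme.hsStratum Y N ν)) :
    NuMod Y N 3 ν :=
  nuMod_of_isolated_of_resolutions 3
    (fun Z _ _ _ hexc hdimZ => hCP Z hexc.isQuasiExcellent (by exact_mod_cast hdimZ)) g hdim3 hdim
    hν hνΦ hdisj

/-- **Dimension `≤ 2`, every level, isolated strata** (conditional on Cossart–Jannsen–Saito 2020,
Thm. 1.2, weak form `CossartJannsenSaito2020General`): the `ν`-wise complement, at the levels where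
the glued `ν`-fact is not available, of the landed `stub_nuMods_surface_of_nuFact`.
[cite: CossartJannsenSaito2020, Thm. 1.2, Def. 6.14] -/
theorem nuMod_dim_le_two_of_isolated (hCJS : CossartJannsenSaito2020General.{0}) {k : Type}
    [Field k] {Y : Scheme.{0}} (g : Y ⟶ Spec (.of k)) [IsSeparated g] [LocallyOfFiniteType g]
    [QuasiCompact g] [IsReduced Y] (hdim2 : topologicalKrullDim Y ≤ ((2 : ℕ) : WithBot ℕ∞))
    {N : ℕ} (hdim : topologicalKrullDim Y ≤ (N : WithBot ℕ∞)) {ν : ℕ → ℕ}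
    (hν : Maximal (· ∈ Scheme.hsValues Y N) ν) (hνΦ : ν ≠ iterPSum N Phi)
    (hdisj : Disjoint (closure ((Scheme.regularLocus Y)ᶜ \ Scheme.hsStratum Y N ν))
      (Scheme.hsStratum Y N ν)) :
    NuMod Y N 2 ν :=
  nuMod_of_isolated_of_resolutions 2
    (fun Z _ _ _ hexc hdimZ => hCJS Z hexc (by exact_mod_cast hdimZ)) g hdim2 hdim hν hνΦ hdisj

end Summit.ResolutionOfSingularities.ResolutionOfSingularities.Theorems.SigmaMaxModificationsCorridor3.TameWild

end
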